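import Mathlib
import HarnessLib

/-!
# Markman 2025 [C] — §11.1, the isometry `ρ_{g₀} = exp(ν)` of `V_ℚ ⊗_F K` IN BLOCK-MATRIX FORM, AS PRINTED,
# kernel-checked as `2 × 2` block identities over a (non-commutative) coefficient ring

E. Markman: [C] *Secant sheaves on abelian n-folds with real multiplication and Weil classes on abelian 2n-folds
with complex multiplication*, arXiv:2509.23079 **v1** (2025-09-27, the only version), bib
`Markman2025SecantRealMultiplication` — UNREFEREED PREPRINT.  «v1 p. N L m» = PyMuPDF line `m` of PDF page `N` of
the public arXiv PDF (sha256/16 `57d91afec2bfe09f`); PRINTED numbering (§11.1 = held-corpus §12.1).  The displays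
below were read BY EYE at seat lit-w-markman (pub-hsemireg LIT-W, 2026-08-23; render `r_mar25c_p36_top.png`, two
seat generations).

## What is printed (verbatim, displays linearised; `V_ℚ := H¹(X, ℚ) ⊕ H¹(X, ℚ)^*`, `F = End_ℚ(X)` totally real,
## `K = F[√−q]`, `η̂_q` = the real-multiplication action of `q ∈ F`, `Θ⌋ : H¹(X, ℚ)^* → H¹(X, ℚ)` contraction)

* v1 p. 35 L54–60 (printed premise: «Assume that `X` is simple and `End_ℚ(X) = F`. Then the subspace `∧²_F H¹(X, ℚ)`
  of `H²(X, ℚ)` contains a Hodge class `Θ`, by Lemma 11.1.1.»): «Contraction with `Θ` induces an `η̂(F)`-equivariant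
  homomorphism `Θ⌋ : H¹(X, ℚ)^* → H¹(X, ℚ)`.
  The element `g` of `Spin(V_ℚ)` corresponding to cup product with `exp(Θ)` acts on `V_ℚ := H¹(X, ℚ) ⊕ H¹(X, ℚ)^*`
  by `ρ_g(w, ξ) = (w − Θ⌋ξ, ξ)`. It follows that `ρ_g` is `η̂(F)`-equivariant
  `f(ρ_g(w, ξ)) = f(w − Θ⌋ξ, ξ) = (f(w) − f(Θ⌋ξ), ξ ∘ f) = (f(w) − Θ⌋(ξ ∘ f), ξ ∘ f) = f(ρ_g(w, ξ))`.» [sic: the last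
  term of the chain is printed `f(ρ_g(w, ξ))`; the intended reading `ρ_g(f(w, ξ))` is what is checked below]
* v1 p. 36 L4–11: «Note that the nilpotent element of square zero `ρ_g − id_{V_ℚ}` depends linearly on `Θ` and
  `ρ_g = exp(ρ_g − id_{V_ℚ})`. We thus define the element `g₀ ∈ Spin(V_{η̂,K})` to be the unique element, such that
  `m_{g₀}` acts on the spin representation `∧^*_K[H¹(X, ℚ) ⊗_F K]` via cup product with `exp(√−q Θ)`, where `q` is an
  element of `F` such that `K = F[√−q]`. The isometry `ρ_{g₀}` of `V_ℚ ⊗_F K` corresponds to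
  `id_{V_ℚ ⊗_F K} + (ρ_g − id) ⊗ √−q`. Explicitly, decompose elements of `V_ℚ ⊗_F K` as `(v₁, v₂ ⊗ √−q)` with
  `vᵢ ∈ V_ℚ`. Then»
* v1 p. 36 L12–20 (three displayed lines):
  «`(ρ_g − id)(v₁, v₂ ⊗ √−q) = ((ρ_g − id)(v₁), (ρ_g − id)(v₂) ⊗ √−q)`,
  `√−q (v₁, v₂ ⊗ √−q) = (η̂_{−q}(v₂), v₁ ⊗ √−q)`,
  `(√−q ∘ (ρ_g − id))(v₁, v₂ ⊗ √−q) = (η̂_{−q}((ρ_g − id)(v₂)), (ρ_g − id)(v₁) ⊗ √−q)`»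
* v1 p. 36 L21–27: «Set `ν := (√−q ∘ (ρ_g − id))`, `ρ_{g₀} := exp(ν)`.»
* v1 p. 36 L28–43 (display): «In block matrix form we have:
  `ν = ( 0 , −η̂_q(ρ_g − id)) ; ρ_g − id , 0 )`, and `exp(ν) = ( 1 , −η̂_q(ρ_g − id)) ; ρ_g − id , 1 )`.»
  [sic: one surplus closing parenthesis after `(ρ_g − id)` in the upper-right entry of both matrices, as printed]
* v1 p. 36 L44–49: «The induced action of `ν` on `∧^*_K[V_ℚ ⊗_F K]` is nilpotent, but no longer of square zero.
  The induced action of `ρ_{g₀}` on `∧^*_K[V_ℚ ⊗_F K]` is still `exp(ν)`. The maximal isotropic subspace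
  `W = ρ_{g₀}(H¹(X̂, ℚ) ⊗_F K)` is the graph of `ν| : H¹(X̂, ℚ) ⊗_F K → H¹(X, ℚ) ⊗_F K` sending `ξ ∈ H¹(X̂, ℚ)` to
  `−(Θ⌋ξ) ⊗ √−q`. Clearly, `W ∩ ι(W) = (0)` verifying Equation (5.1.6).»

* The imaginary-quadratic prototype, [M] = E. Markman, arXiv:2502.03415 **v2** (bib `Markman2025SecantWeil`, PREPRINT),
  §2.4 p. 21 L3–44 (`K = ℚ[√−d]`, `u := √−dΘ`, `θ : H¹(X̂) → H¹(X)`): (2.4.4) «`exp(u) · (w, y) = (w − √−dθ(y), y)`,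
  `w ∈ H¹(X, K)` and `y ∈ H¹(X̂, K) ≅ H¹(X, K)^*`»; (2.4.6) «`W₁ := exp(u)(H¹(X, K)^*) = {(−√−dθ(y), y) : y ∈ H¹(X, K)^*}`,
  `W₂ := W̄₁ = {(+√−dθ(y), y) : y ∈ H¹(X, K)^*}`. The intersection `W₁ ∩ W₂` is the zero subspace, since `θ` is an
  isomorphism.» — the same two sentences as [C]'s graph sentence and «Clearly, `W ∩ ι(W) = (0)`», with the
  injectivity of `θ` stated; LEVEL 2 below covers both (take `T := √−d·θ`, resp. `T := Θ⌋`).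

## The model and what this file proves (NO named fact; nothing geometric)
LEVEL 1 (the block display).  `R` is any ring, standing for `End_F(V_ℚ)`; `N ∈ R` stands for `ρ_g − id` and
`e ∈ R` for `η̂_q` (multiplication by `q ∈ F`, which commutes with the `F`-linear `N`).  An element
`v₁ + v₂ ⊗ √−q` of `V_ℚ ⊗_F K` is the column `(v₁, v₂)`; `R` acts on a module `M` (standing for `V_ℚ`) and a
`2 × 2` matrix over `R` acts on pairs by `act`.  In these coordinates `√−q` is `J e := !![0, −e; 1, 0]`,
`(ρ_g − id) ⊗ 1` is `D N := !![N, 0; 0, N]`, and `ν = J e * D N`.  PROVED: the three displayed lines (`act_D`,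
`act_J`, `act_nu`); `J e * D N = !![0, −(e*N); N, 0]` (`nu_eq`, the printed `ν`); `J e * J e = −e` as a scalar
block (`J_sq`, i.e. `(√−q)² = −q`); from `N * N = 0` and `Commute e N`: `ν * ν = 0` (`nu_sq`) and, over a
`ℚ`-algebra, Mathlib's finite exponential gives `exp(ν) = 1 + ν = !![1, −(e*N); N, 1]` (`exp_nu`, the printed
`exp(ν)`) and `exp(N) = 1 + N` (`exp_eq_one_add`, i.e. «`ρ_g = exp(ρ_g − id)`»).
LEVEL 2 (the graph sentence).  Over a field `𝕜` (standing for `F`, or for `K` after base change), `V = W × Ξ` with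
`W` standing for `H¹(X, ℚ)`, `Ξ` for `H¹(X, ℚ)^* = H¹(X̂, ℚ)`, and a linear map `T : Ξ →ₗ W` standing for `Θ⌋`;
`rhoSubId T (w, ξ) := (−T ξ, 0)`.  PROVED: `ρ_g(w, ξ) = (w − Tξ, ξ)` (`rho_apply`); `(ρ_g − id)² = 0`
(`rhoSubId_sq`); the `η̂(F)`-equivariance chain for any pair of maps `f_W, f_Ξ` with `f_W ∘ T = T ∘ f_Ξ`
(`rho_equivariant`); `exp(ν)` sends the column `((0, ξ), 0)` to `((0, ξ), (−Tξ, 0))`, i.e. `ξ ↦ ξ + (−Θ⌋ξ) ⊗ √−q`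
(`expnu_act_xi`, the graph sentence); and, with `ι` acting by `√−q ↦ −√−q` on the second coordinate, a vector in
`W ∩ ι(W)` has `2·T ξ = 0`, so `ξ = 0` as soon as `T` is injective and `char 𝕜 ≠ 2` (`graph_inter_conj`, the
«Clearly» — print does not spell out the injectivity of `Θ⌋` it uses).
NOT covered: the spin representation `m_{g₀}`, `exp(√−q Θ)` and (11.1.1), the induced action on `∧^*`, isotropy of
`W`, Equation (5.1.6) itself, and everything about `X`, `Θ`, `F`, `K`.  Bookkeeping for the pub-hsemireg LIT-W sheet
§4 / W3 rows reading [C] §11; it says nothing about semiregularity or the Hodge conjecture and re-proves no theorem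
of [C].
-/

namespace Literature.AlgebraicGeometry.Markman2025

namespace RMIsometryBlockForm

open Matrix

section LevelOne

variable {R : Type*} [Ring R]

/-- `√−q` on `V_ℚ ⊗_F K` in the coordinates `(v₁, v₂ ⊗ √−q)`: `(v₁, v₂) ↦ (−q·v₂, v₁)`; `e` stands for `η̂_q`.
[cite: Markman2025SecantRealMultiplication, §11.1, v1 p. 36 L15–17 (transcription of an unrefereed preprint)] -/
def J (e : R) : Matrix (Fin 2) (Fin 2) R := !![0, -e; 1, 0]

/-- `(ρ_g − id) ⊗ 1` on `V_ℚ ⊗_F K`: the diagonal block `N ⊕ N`, `N` standing for `ρ_g − id`.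
[cite: Markman2025SecantRealMultiplication, §11.1, v1 p. 36 L12–14 (transcription)] -/
def D (N : R) : Matrix (Fin 2) (Fin 2) R := !![N, 0; 0, N]

/-- The printed block matrix of `ν := √−q ∘ (ρ_g − id)`: `( 0 , −η̂_q(ρ_g − id) ; ρ_g − id , 0 )`.
[cite: Markman2025SecantRealMultiplication, §11.1, v1 p. 36 L28–35 (transcription)] -/
def nu (e N : R) : Matrix (Fin 2) (Fin 2) R := !![0, -(e * N); N, 0]

/-- The printed block matrix of `exp(ν)`: `( 1 , −η̂_q(ρ_g − id) ; ρ_g − id , 1 )`.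
[cite: Markman2025SecantRealMultiplication, §11.1, v1 p. 36 L36–43 (transcription)] -/
def expnu (e N : R) : Matrix (Fin 2) (Fin 2) R := !![1, -(e * N); N, 1]

/-- Action of a `2 × 2` block matrix over `R` on a column `(v₁, v₂)` of an `R`-module (the coordinates
`v₁ + v₂ ⊗ √−q` of `V_ℚ ⊗_F K`). [folklore] -/
def act {M : Type*} [AddCommGroup M] [Module R M] (A : Matrix (Fin 2) (Fin 2) R) (v : M × M) : M × M :=
  (A 0 0 • v.1 + A 0 1 • v.2, A 1 0 • v.1 + A 1 1 • v.2)

variable {M : Type*} [AddCommGroup M] [Module R M]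

/-- `act` is multiplicative: `(A * B) · v = A · (B · v)` (private plumbing). [folklore] -/
private theorem act_mul (A B : Matrix (Fin 2) (Fin 2) R) (v : M × M) : act (A * B) v = act A (act B v) := by
  obtain ⟨v₁, v₂⟩ := v
  simp only [act, Matrix.mul_apply, Fin.sum_univ_two, add_smul, mul_smul, smul_add, Prod.mk.injEq]
  exact ⟨by abel, by abel⟩

/-- `act 1 v = v` (private plumbing). [folklore] -/
private theorem act_one (v : M × M) : act (1 : Matrix (Fin 2) (Fin 2) R) v = v := by
  obtain ⟨v₁, v₂⟩ := v
  simp [act]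

/-- `act` is additive in the matrix (private plumbing). [folklore] -/
private theorem act_add (A B : Matrix (Fin 2) (Fin 2) R) (v : M × M) : act (A + B) v = act A v + act B v := by
  obtain ⟨v₁, v₂⟩ := v
  simp only [act, Matrix.add_apply, add_smul, Prod.mk_add_mk, Prod.mk.injEq]
  exact ⟨by abel, by abel⟩

/-- **First displayed line, v1 p. 36 L12–14** «`(ρ_g − id)(v₁, v₂ ⊗ √−q) = ((ρ_g − id)(v₁), (ρ_g − id)(v₂) ⊗ √−q)`».
[cite: Markman2025SecantRealMultiplication, §11.1, v1 p. 36 L12–14 (transcription)] -/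
theorem act_D (N : R) (v₁ v₂ : M) : act (D N) (v₁, v₂) = (N • v₁, N • v₂) := by
  simp [act, D]

/-- **Second displayed line, v1 p. 36 L15–17** «`√−q (v₁, v₂ ⊗ √−q) = (η̂_{−q}(v₂), v₁ ⊗ √−q)`»
(`η̂_{−q} = −η̂_q`, here `−e`). [cite: Markman2025SecantRealMultiplication, §11.1, v1 p. 36 L15–17 (transcription)] -/
theorem act_J (e : R) (v₁ v₂ : M) : act (J e) (v₁, v₂) = (-(e • v₂), v₁) := by
  simp [act, J, neg_smul]

/-- **`ν = √−q ∘ (ρ_g − id)` is the printed block matrix** (v1 p. 36 L21–35): `J e * D N = ( 0 , −(e N) ; N , 0 )`.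
[cite: Markman2025SecantRealMultiplication, §11.1, v1 p. 36 L21–35 (transcription)] -/
theorem nu_eq (e N : R) : J e * D N = nu e N := by
  ext i j
  fin_cases i <;> fin_cases j <;> simp [J, D, nu, Matrix.mul_apply, Fin.sum_univ_two]

/-- **Third displayed line, v1 p. 36 L18–20**
«`(√−q ∘ (ρ_g − id))(v₁, v₂ ⊗ √−q) = (η̂_{−q}((ρ_g − id)(v₂)), (ρ_g − id)(v₁) ⊗ √−q)`».
[cite: Markman2025SecantRealMultiplication, §11.1, v1 p. 36 L18–20 (transcription)] -/
theorem act_nu (e N : R) (v₁ v₂ : M) : act (nu e N) (v₁, v₂) = (-(e • N • v₂), N • v₁) := by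
  simp [act, nu, neg_smul, mul_smul]

/-- The same third line obtained by COMPOSING the first two (`ν = √−q ∘ (ρ_g − id)`), a consistency check of the
three displays. [cite: Markman2025SecantRealMultiplication, §11.1, v1 p. 36 L12–27 (transcription)] -/
theorem act_J_act_D (e N : R) (v₁ v₂ : M) : act (J e) (act (D N) (v₁, v₂)) = (-(e • N • v₂), N • v₁) := by
  rw [← act_mul, nu_eq, act_nu]

/-- `(√−q)² = −q`: `J e * J e` is the scalar block `−e`. [cite: Markman2025SecantRealMultiplication, §11.1,
v1 p. 36 L9–11 («`K = F[√−q]`»; transcription)] -/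
theorem J_sq (e : R) : J e * J e = !![-e, 0; 0, -e] := by
  ext i j
  fin_cases i <;> fin_cases j <;> simp [J, Matrix.mul_apply, Fin.sum_univ_two]

/-- `√−q` commutes with `(ρ_g − id) ⊗ 1` as soon as `η̂_q` commutes with `ρ_g − id` (both are `F`-linear):
`J e * D N = D N * J e`. [cite: Markman2025SecantRealMultiplication, §11.1, v1 p. 36 L9–27 (transcription)] -/
theorem J_mul_D_comm (e N : R) (h : Commute e N) : J e * D N = D N * J e := by
  ext i j
  fin_cases i <;> fin_cases j <;> simp [J, D, Matrix.mul_apply, Fin.sum_univ_two, h.eq]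

/-- **`ν² = 0` on `V_ℚ ⊗_F K`** (so that `exp(ν) = 1 + ν`, the printed matrix): from `(ρ_g − id)² = 0`
(v1 p. 36 L4–5 «the nilpotent element of square zero `ρ_g − id_{V_ℚ}`») and `η̂_q (ρ_g − id) = (ρ_g − id) η̂_q`.
(Print, L44–45: on `∧^*_K[V_ℚ ⊗_F K]` the INDUCED action of `ν` «is nilpotent, but no longer of square zero» — not
modelled.) [cite: Markman2025SecantRealMultiplication, §11.1, v1 p. 36 L4–5 and L28–45 (transcription)] -/
theorem nu_sq (e N : R) (hN : N * N = 0) (h : Commute e N) : nu e N * nu e N = 0 := by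
  have h1 : e * N * N = 0 := by rw [mul_assoc, hN, mul_zero]
  have h2 : N * (e * N) = 0 := by rw [← mul_assoc, ← h.eq, mul_assoc, hN, mul_zero]
  ext i j
  fin_cases i <;> fin_cases j <;> simp [nu, Matrix.mul_apply, Fin.sum_univ_two, h1, h2]

/-- The printed `exp(ν)` is `1 + ν`. [cite: Markman2025SecantRealMultiplication, §11.1, v1 p. 36 L28–43
(transcription)] -/
theorem expnu_eq_one_add (e N : R) : expnu e N = 1 + nu e N := by
  ext i j
  fin_cases i <;> fin_cases j <;> simp [expnu, nu]

end LevelOne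

section Exponential

variable {R : Type*} [Ring R] [Algebra ℚ R]

/-- A square-zero element has `exp(N) = 1 + N` (Mathlib's finite exponential `IsNilpotent.exp`): the printed
«`ρ_g = exp(ρ_g − id_{V_ℚ})`» for the square-zero `ρ_g − id`.
[cite: Markman2025SecantRealMultiplication, §11.1, v1 p. 36 L4–5 (transcription)] -/
theorem exp_eq_one_add {N : R} (hN : N * N = 0) : IsNilpotent.exp N = 1 + N := by
  have h2 : N ^ 2 = 0 := by rw [pow_two, hN]
  rw [IsNilpotent.exp_eq_sum h2, Finset.sum_range_succ, Finset.sum_range_succ, Finset.sum_range_zero]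
  simp

/-- **The printed block form of `ρ_{g₀} := exp(ν)`** (v1 p. 36 L25–43): with `(ρ_g − id)² = 0` and
`η̂_q (ρ_g − id) = (ρ_g − id) η̂_q`, `exp(ν) = ( 1 , −η̂_q(ρ_g − id) ; ρ_g − id , 1 )` — here for Mathlib's
`IsNilpotent.exp` in the `ℚ`-algebra of `2 × 2` block matrices over `R`.
[cite: Markman2025SecantRealMultiplication, §11.1, v1 p. 36 L25–43 (transcription)] -/
theorem exp_nu (e N : R) (hN : N * N = 0) (h : Commute e N) :
    IsNilpotent.exp (nu e N) = expnu e N := by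
  rw [exp_eq_one_add (nu_sq e N hN h), expnu_eq_one_add]

/-- «The isometry `ρ_{g₀}` of `V_ℚ ⊗_F K` corresponds to `id_{V_ℚ ⊗_F K} + (ρ_g − id) ⊗ √−q`» (v1 p. 36 L9–10):
in the block model `exp(ν) = 1 + J e * D N` (`√−q` composed with `(ρ_g − id) ⊗ 1`).
[cite: Markman2025SecantRealMultiplication, §11.1, v1 p. 36 L9–10 and L21–27 (transcription)] -/
theorem exp_nu_eq_one_add_J_mul_D (e N : R) (hN : N * N = 0) (h : Commute e N) :
    IsNilpotent.exp (nu e N) = 1 + J e * D N := by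
  rw [exp_nu e N hN h, expnu_eq_one_add, nu_eq]

end Exponential

section LevelTwo

variable {𝕜 : Type*} [Field 𝕜] {W Ξ : Type*} [AddCommGroup W] [Module 𝕜 W] [AddCommGroup Ξ] [Module 𝕜 Ξ]

/-- `ρ_g − id` on `V = H¹(X) ⊕ H¹(X)^*`: `(w, ξ) ↦ (−Θ⌋ξ, 0)`, with `T` standing for `Θ⌋ : H¹(X)^* → H¹(X)`.
[cite: Markman2025SecantRealMultiplication, §11.1, v1 p. 35 L56–59 (transcription)] -/
def rhoSubId (T : Ξ →ₗ[𝕜] W) : (W × Ξ) →ₗ[𝕜] (W × Ξ) :=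
  (LinearMap.inl 𝕜 W Ξ) ∘ₗ (-T) ∘ₗ (LinearMap.snd 𝕜 W Ξ)

/-- `(ρ_g − id)(w, ξ) = (−Θ⌋ξ, 0)`, unfolding `rhoSubId`.
[cite: Markman2025SecantRealMultiplication, §11.1, v1 p. 35 L56–59 (transcription)] -/
@[simp] theorem rhoSubId_apply (T : Ξ →ₗ[𝕜] W) (w : W) (ξ : Ξ) : rhoSubId T (w, ξ) = (-(T ξ), 0) := by
  simp [rhoSubId]

/-- **v1 p. 35 L58–59** «`ρ_g(w, ξ) = (w − Θ⌋ξ, ξ)`»: `(1 + (ρ_g − id))(w, ξ) = (w − Tξ, ξ)`; with `T := √−d·θ` over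
`K` this is also [M] (2.4.4) «`exp(u) · (w, y) = (w − √−dθ(y), y)`».
[cite: Markman2025SecantRealMultiplication, §11.1, v1 p. 35 L56–59 (transcription)]
[cite: Markman2025SecantWeil, (2.4.4), v2 p. 21 L10–14 (transcription)] -/
theorem rho_apply (T : Ξ →ₗ[𝕜] W) (w : W) (ξ : Ξ) : (1 + rhoSubId T) (w, ξ) = (w - T ξ, ξ) := by
  simp [sub_eq_add_neg]

/-- **v1 p. 36 L4–5** «the nilpotent element of square zero `ρ_g − id_{V_ℚ}`»: `(ρ_g − id) ∘ (ρ_g − id) = 0`.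
[cite: Markman2025SecantRealMultiplication, §11.1, v1 p. 36 L4–5 (transcription)] -/
theorem rhoSubId_sq (T : Ξ →ₗ[𝕜] W) : rhoSubId T * rhoSubId T = 0 := by
  apply LinearMap.ext
  rintro ⟨w, ξ⟩
  rw [Module.End.mul_apply, rhoSubId_apply, rhoSubId_apply, map_zero, neg_zero, LinearMap.zero_apply,
    Prod.mk_zero_zero]

/-- **v1 p. 35 L59–60, the `η̂(F)`-equivariance chain** «`f(ρ_g(w, ξ)) = f(w − Θ⌋ξ, ξ) = (f(w) − f(Θ⌋ξ), ξ ∘ f)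
= (f(w) − Θ⌋(ξ ∘ f), ξ ∘ f) = [ρ_g(f(w, ξ))]`»: for any pair of linear maps `f_W`, `f_Ξ` (standing for the action
of `f ∈ F` on `H¹(X)` and, by transpose, on `H¹(X)^*`) with `f_W ∘ T = T ∘ f_Ξ` («`Θ⌋` is `η̂(F)`-equivariant»,
L56–57), `(f_W × f_Ξ) ∘ ρ_g = ρ_g ∘ (f_W × f_Ξ)`.
[cite: Markman2025SecantRealMultiplication, §11.1, v1 p. 35 L56–60 (transcription)] -/
theorem rho_equivariant (T : Ξ →ₗ[𝕜] W) (fW : W →ₗ[𝕜] W) (fΞ : Ξ →ₗ[𝕜] Ξ) (hT : fW ∘ₗ T = T ∘ₗ fΞ)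
    (w : W) (ξ : Ξ) : (fW.prodMap fΞ) ((1 + rhoSubId T) (w, ξ)) = (1 + rhoSubId T) (fW w, fΞ ξ) := by
  have hT' : fW (T ξ) = T (fΞ ξ) := by
    simpa using LinearMap.congr_fun hT ξ
  simp [map_add, map_neg, hT']

/-- **v1 p. 36 L46–49, the graph sentence** «`W = ρ_{g₀}(H¹(X̂, ℚ) ⊗_F K)` is the graph of
`ν| : H¹(X̂, ℚ) ⊗_F K → H¹(X, ℚ) ⊗_F K` sending `ξ ∈ H¹(X̂, ℚ)` to `−(Θ⌋ξ) ⊗ √−q`»: in the block model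
(`V = W × Ξ` as the `R = End(V)`-module, `N = ρ_g − id`, any `e`), `exp(ν) = expnu e N` sends the column
`((0, ξ), 0)` — the element `ξ` of `H¹(X̂) ⊂ V ⊂ V ⊗ K` — to `((0, ξ), (−Tξ, 0))`, i.e. to `ξ + (−Θ⌋ξ) ⊗ √−q`.
[cite: Markman2025SecantRealMultiplication, §11.1, v1 p. 36 L46–49 (transcription)] -/
theorem expnu_act_xi (T : Ξ →ₗ[𝕜] W) (e : Module.End 𝕜 (W × Ξ)) (ξ : Ξ) :
    act (expnu e (rhoSubId T)) (((0 : W), ξ), ((0 : W), (0 : Ξ))) = ((0, ξ), (-(T ξ), 0)) := by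
  simp [act, expnu, Prod.mk_zero_zero]

/-- **v1 p. 36 L49** «Clearly, `W ∩ ι(W) = (0)`»: `ι` (complex conjugation, `√−q ↦ −√−q`) negates the second
coordinate, so `ι(W)` is the graph of `ξ ↦ +(Θ⌋ξ) ⊗ √−q`; a common vector `((0, ξ), (−Tξ, 0)) = ((0, ξ′), (Tξ′, 0))`
forces `ξ = ξ′` and `2·Tξ = 0`, hence `ξ = 0` when `Θ⌋` is injective and `2 ≠ 0` in `𝕜` (the injectivity of `Θ⌋`
is used, not stated, in [C]; [M] (2.4.6), v2 p. 21 L44, states it: «The intersection `W₁ ∩ W₂` is the zero subspace,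
since `θ` is an isomorphism.» — the same lemma with `T := √−d·θ`).
[cite: Markman2025SecantRealMultiplication, §11.1, v1 p. 36 L46–49 (transcription)]
[cite: Markman2025SecantWeil, (2.4.6), v2 p. 21 L29–44 (transcription)] -/
theorem graph_inter_conj [NeZero (2 : 𝕜)] (T : Ξ →ₗ[𝕜] W) (hT : Function.Injective T) (ξ ξ' : Ξ)
    (h : (((0 : W), ξ), (-(T ξ), (0 : Ξ))) = (((0 : W), ξ'), (T ξ', (0 : Ξ)))) : ξ = 0 ∧ ξ' = 0 := by
  simp only [Prod.mk.injEq] at h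
  obtain ⟨⟨-, hξ⟩, hT2, -⟩ := h
  subst hξ
  have h2 : (2 : 𝕜) • T ξ = 0 := by
    rw [two_smul]
    nth_rewrite 1 [← neg_neg (T ξ)]
    rw [hT2, neg_add_cancel]
  have hT0 : T ξ = 0 := by
    rcases smul_eq_zero.mp h2 with h | h
    · exact absurd h (NeZero.ne 2)
    · exact h
  have : ξ = 0 := hT (by rw [hT0, map_zero])
  exact ⟨this, this⟩

end LevelTwo

end RMIsometryBlockForm

end Literature.AlgebraicGeometry.Markman2025
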